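import Summits.AtomisticToContinuum.Crystallization.Theorems.FrustratedLawDichotomyFrustrationDensityGapDoor
import Summits.AtomisticToContinuum.Crystallization.Theorems.FrustratedLawDichotomyLocalCloseOrderUniform
import Summits.AtomisticToContinuum.Crystallization.Theorems.FrustratedLawDichotomyPeriodicGapChargeDoor

/-!
# FrustratedLawDichotomy · cruxes `AperiodicFrustratedLawGap` (27623) / `PeriodicFrustratedLawGap` (27624) / `PeriodicChargeSplit.NoFrustratedPeriodicMinimiser`
# (26654) — THE LOCAL-CLOSE-ORDER STATEMENT AT SET LEVEL, AND THE PERIODIC SIDE DOOR-FREE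
# (decomp-a2c, prover hand 2, structural share, generation 7)

`LCO` / `FDG` (generation 7: `FrustratedLawDichotomyLocalCloseOrder`, `…LocalCloseOrderFinite`) were stated for ROOTED sets.  Re-rooting
(`isMuGSC_image_sub`, `robustGood`-translation) and hand-1's texture transfer (`not_robustGood_of_texture`) give the set-level form:

* `not_isMuGSC_of_textured_set` : under `LCO`, NO nonempty `δ`-separated set `S ⊆ ℝ³` that is texture-approachable at every atom (separation
  of the approximants, clause (2) «all-1/20-bad», two-way matching — radii-free) is an `e⋆`-μGSC of `V_LJ` (no root, no Nash, no periodicity);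
* `rGSCperQ_of_localCloseOrder` : hence the periodic-translate residual `R_GSC^perQ` of generation 5 (text verbatim);
* `noFrustratedPeriodicMinimiser_of_localCloseOrder` : **`LCO → NoFrustratedPeriodicMinimiser` (crux D of `PeriodicChargeSplit`, item 26654)
  DOOR-FREE** (via the unconditional periodic μGSC theorem of generation 5, `noFrustratedPeriodicMinimiser_of_noTexturedPeriodicGSC`);
* `periodicFrustratedLawGap_of_charge_of_localCloseOrder` : `PeriodicMinimiserCharge (26655) → LCO → PeriodicFrustratedLawGap (27624)` DOOR-FREE;
* the same two from the finite frustration density gap `FDG` (`…_of_frustrationDensityGap`).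

So after generation 7 the dichotomy's two cruxes read: Φaper ⟸ `MuEquilibriumDoor ∧ FDG`, Φper ⟸ `PeriodicMinimiserCharge ∧ FDG`, D ⟸ `FDG` —
one finite crystallization statement (`FDG`, open) beneath all three.  `[folklore]` bookkeeping.
-/

noncomputable section

namespace Summit.AtomisticToContinuum.Crystallization.Theorems.FrustratedLawDichotomyLocalCloseOrderPeriodic

open MeasureTheory
open Literature.MathematicalPhysics.StatisticalMechanics
open Literature.Probability.Process (IsRootedHardCore count_restrict_singleton_ne_zero_iff)
open Summit.AtomisticToContinuum.Crystallization.Theorems.ChargedEnergyGapNegative (E3 eStar)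
open Summit.AtomisticToContinuum.Crystallization.Theorems.FrustratedLawDichotomyHardCoreUpgrade (sep_of_twoWayMatching)
open Summit.AtomisticToContinuum.Crystallization.Theorems.FrustratedLawDichotomyTextureAllBad (not_robustGood_of_texture)
open Summit.AtomisticToContinuum.Crystallization.Theorems.RepetitiveNetworkReductionRecurrentMember (isMuGSC_image_sub)
open Summit.AtomisticToContinuum.Crystallization.Theorems.FrustratedLawDichotomyLocalCloseOrderFinite (localCloseOrder_of_frustrationDensityGap)
open Summit.AtomisticToContinuum.Crystallization.Theorems.FrustratedLawDichotomyPeriodicChargeSplitGSCDoor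
  (noFrustratedPeriodicMinimiser_of_noTexturedPeriodicGSC)
open Summit.AtomisticToContinuum.Crystallization.Theorems.FrustratedLawDichotomyPeriodicGapChargeDoor
  (periodicFrustratedLawGap_of_charge_of_noTexturedPeriodicGSC)

/-- **SET LEVEL: under `LCO`, no nonempty separated texture-approachable set is an `e⋆`-μGSC of `V_LJ`.**  Re-root at an atom `p`
(`isMuGSC_image_sub`), apply `LCO` to the rooted translate, and contradict hand-1's `not_robustGood_of_texture` for the counting measure of the
translate (the texture hypothesis is translation-covariant). [folklore] -/
theorem not_isMuGSC_of_textured_set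
    (hLCO : ∀ X : Set (EuclideanSpace ℝ (Fin 3)), (0 : EuclideanSpace ℝ (Fin 3)) ∈ X → (∀ a ∈ X, ∀ b ∈ X, a ≠ b → (7 : ℝ) / 10 ≤ dist a b) → Literature.MathematicalPhysics.StatisticalMechanics.IsMuGSC Literature.MathematicalPhysics.StatisticalMechanics.lennardJones (⨅ Q : Literature.MathematicalPhysics.StatisticalMechanics.PeriodicConfiguration 3, Q.energyPerParticle Literature.MathematicalPhysics.StatisticalMechanics.lennardJones) X → ∃ p : EuclideanSpace ℝ (Fin 3), p ∈ X ∧ ∃ (d η γ : ℝ) (A : EuclideanSpace ℝ (Fin 3) →ₗᵢ[ℝ] EuclideanSpace ℝ (Fin 3)), (∃ t : ↥Literature.Geometry.DiscreteGeometry.fccKissingPattern → EuclideanSpace ℝ (Fin 3), 0 < d ∧ 0 < γ ∧ η < 1 / 20 ∧ (∀ u : ↥Literature.Geometry.DiscreteGeometry.fccKissingPattern, t u ∈ X ∧ ‖(t u - p) - d • A (u : EuclideanSpace ℝ (Fin 3))‖ ≤ η * d) ∧ (∀ s : EuclideanSpace ℝ (Fin 3), s ∈ X → s ≠ p → d ≤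 dist s p) ∧ (∃ s : EuclideanSpace ℝ (Fin 3), s ∈ X ∧ s ≠ p ∧ dist s p ≤ d) ∧ (∀ s : EuclideanSpace ℝ (Fin 3), s ∈ X → s ≠ p → dist s p < 13 / 10 * d + γ → dist s p ≤ 13 / 10 * d - γ ∧ s ∈ Set.range t)) ∨ (∃ t : ↥Literature.Geometry.DiscreteGeometry.hcpKissingPattern → EuclideanSpace ℝ (Fin 3), 0 < d ∧ 0 < γ ∧ η < 1 / 20 ∧ (∀ u : ↥Literature.Geometry.DiscreteGeometry.hcpKissingPattern, t u ∈ X ∧ ‖(t u - p) - d • A (u : EuclideanSpace ℝ (Fin 3))‖ ≤ η * d) ∧ (∀ s : EuclideanSpace ℝ (Fin 3), s ∈ X → s ≠ p → d ≤ dist s p) ∧ (∃ s : EuclideanSpace ℝ (Fin 3), s ∈ X ∧ s ≠ p ∧ dist s p ≤ d) ∧ (∀ s : EuclideanSpace ℝ (Fin 3), s ∈ X → s ≠ p → dist s p < 13 / 10 * d + γ → dist s p ≤ 13 / 10 * d - γ ∧ s ∈ Set.range t)))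
    {δ : ℝ} (hδ : 0 < δ) {S : Set (EuclideanSpace ℝ (Fin 3))} (hne : S.Nonempty) (hsep : ∀ a ∈ S, ∀ b ∈ S, a ≠ b → δ ≤ dist a b)
    (hA : ∀ q ∈ S, ∀ R ε : ℝ, 0 < ε → ∃ (N : ℕ) (y : Fin N → EuclideanSpace ℝ (Fin 3)) (i : Fin N), (∀ a b : Fin N, a ≠ b → (7 : ℝ) / 10 ≤ dist (y a) (y b)) ∧ (∀ j : Fin N, dist (y j) (y i) ≤ R → ¬ ∃ A : EuclideanSpace ℝ (Fin 3) →ₗᵢ[ℝ] EuclideanSpace ℝ (Fin 3), (∃ e : ↥{z : EuclideanSpace ℝ (Fin 3) | z ∈ Set.range y ∧ z ≠ y j ∧ dist z (y j) < 13 / 10 * sInf ((fun z => dist z (y j)) '' (Set.range y \ {y j}))} ≃ ↥Literature.Geometry.DiscreteGeometry.fccKissingPattern, ∀ t : ↥{z : EuclideanSpace ℝ (Fin 3) | z ∈ Set.range y ∧ z ≠ y j ∧ dist z (y j) < 13 / 10 * sInf ((fun z => dist z (y j)) '' (Set.range y \ {y j}))}, dist ((sInf ((fun z => dist z (y j)) ''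 (Set.range y \ {y j})))⁻¹ • ((t : EuclideanSpace ℝ (Fin 3)) - y j)) (A ((e t : ↥Literature.Geometry.DiscreteGeometry.fccKissingPattern) : EuclideanSpace ℝ (Fin 3))) ≤ 1 / 20) ∨ (∃ e : ↥{z : EuclideanSpace ℝ (Fin 3) | z ∈ Set.range y ∧ z ≠ y j ∧ dist z (y j) < 13 / 10 * sInf ((fun z => dist z (y j)) '' (Set.range y \ {y j}))} ≃ ↥Literature.Geometry.DiscreteGeometry.hcpKissingPattern, ∀ t : ↥{z : EuclideanSpace ℝ (Fin 3) | z ∈ Set.range y ∧ z ≠ y j ∧ dist z (y j) < 13 / 10 * sInf ((fun z => dist z (y j)) '' (Set.range y \ {y j}))}, dist ((sInf ((fun z => dist z (y j)) '' (Set.range y \ {y j})))⁻¹ • ((t : EuclideanSpace ℝ (Fin 3)) - y j)) (A ((e t : ↥Literature.Geometry.DiscreteGeometry.hcpKissingPattern) : EuclideanSpace ℝ (Fin 3))) ≤ 1 / 20)) ∧ (∀ s ∈ S, dist s q ≤ R → ∃ a : Fin N, dist (y a - y i) (s - q) ≤ ε) ∧ (∀ a : Fin N, dist (y a) (y i) ≤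 R → ∃ s ∈ S, dist (y a - y i) (s - q) ≤ ε)) :
    ¬ Literature.MathematicalPhysics.StatisticalMechanics.IsMuGSC Literature.MathematicalPhysics.StatisticalMechanics.lennardJones (⨅ Q : Literature.MathematicalPhysics.StatisticalMechanics.PeriodicConfiguration 3, Q.energyPerParticle Literature.MathematicalPhysics.StatisticalMechanics.lennardJones) S := by
  intro hGSC
  obtain ⟨p, hp⟩ := hne
  -- the rooted translate
  have hmem : ∀ s : EuclideanSpace ℝ (Fin 3), s ∈ (fun x => x - p) '' S ↔ s + p ∈ S := fun s => by
    constructor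
    · rintro ⟨x, hx, rfl⟩; simpa using hx
    · intro hs; exact ⟨s + p, hs, by simp⟩
  have h0 : (0 : EuclideanSpace ℝ (Fin 3)) ∈ (fun x => x - p) '' S := ⟨p, hp, sub_self p⟩
  have hsep7 : ∀ a ∈ S, ∀ b ∈ S, a ≠ b → (7 : ℝ) / 10 ≤ dist a b :=
    sep_of_twoWayMatching fun q hq R ε hε => by
      obtain ⟨N, y, i, hs, -, hm1, -⟩ := hA q hq R ε hε
      exact ⟨N, y, i, hs, hm1⟩
  have hsep' : ∀ a ∈ (fun x => x - p) '' S, ∀ b ∈ (fun x => x - p) '' S, a ≠ b → δ ≤ dist a b := by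
    rintro _ ⟨a, ha, rfl⟩ _ ⟨b, hb, rfl⟩ hne
    rw [dist_sub_right]; exact hsep a ha b hb fun h => hne (by rw [h])
  have hsep7' : ∀ a ∈ (fun x => x - p) '' S, ∀ b ∈ (fun x => x - p) '' S, a ≠ b → (7 : ℝ) / 10 ≤ dist a b := by
    rintro _ ⟨a, ha, rfl⟩ _ ⟨b, hb, rfl⟩ hne
    rw [dist_sub_right]; exact hsep7 a ha b hb fun h => hne (by rw [h])
  have hGSC' := isMuGSC_image_sub hδ hsep hGSC p
  obtain ⟨p', hp', d, η, γ, A, hgood⟩ := hLCO _ h0 hsep7' hGSC'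
  -- the counting measure of the translate is rooted hard-core and texture-approachable
  set μ' : Measure (EuclideanSpace ℝ (Fin 3)) := (Measure.count : Measure (EuclideanSpace ℝ (Fin 3))).restrict ((fun x => x - p) '' S) with hμ'
  have hcore' : IsRootedHardCore δ μ' := ⟨_, h0, hsep', rfl⟩
  have hat : ∀ s : EuclideanSpace ℝ (Fin 3), μ' {s} ≠ 0 ↔ s ∈ (fun x => x - p) '' S := fun s => count_restrict_singleton_ne_zero_iff _ s
  have hbad := not_robustGood_of_texture hδ hcore' (fun q hq R ε hε => by
      have hqS : q + p ∈ S := (hmem q).1 ((hat q).1 hq)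
      obtain ⟨N, y, i, hs, h2, hm1, hm2⟩ := hA (q + p) hqS R ε hε
      refine ⟨N, y, i, hs, h2, fun s hs' hsq => ?_, fun a ha => ?_⟩
      · have hsS : s + p ∈ S := (hmem s).1 ((hat s).1 hs')
        have := hm1 (s + p) hsS (by rwa [dist_add_right])
        rwa [add_sub_add_right_eq_sub] at this
      · obtain ⟨s, hsS, hds⟩ := hm2 a ha
        refine ⟨s - p, (hat _).2 ((hmem _).2 (by simpa using hsS)), ?_⟩
        rwa [sub_sub, add_comm p q]) ((hat p').2 hp') d η γ A
  rcases hgood with ⟨t, hd, hγ, hη, ht, hnn₁, hnn₂, hgap⟩ | ⟨t, hd, hγ, hη, ht, hnn₁, hnn₂, hgap⟩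
  · obtain ⟨s, hs, hsp, hsd⟩ := hnn₂
    exact hbad.1 t ⟨hd, hγ, hη, fun u => ⟨(hat _).2 (ht u).1, (ht u).2⟩, fun s hs => hnn₁ s ((hat s).1 hs),
      ⟨s, (hat s).2 hs, hsp, hsd⟩, fun s hs => hgap s ((hat s).1 hs)⟩
  · obtain ⟨s, hs, hsp, hsd⟩ := hnn₂
    exact hbad.2 t ⟨hd, hγ, hη, fun u => ⟨(hat _).2 (ht u).1, (ht u).2⟩, fun s hs => hnn₁ s ((hat s).1 hs),
      ⟨s, (hat s).2 hs, hsp, hsd⟩, fun s hs => hgap s ((hat s).1 hs)⟩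

/-- **`LCO → R_GSC^perQ`** (the periodic-translate residual of generation 5, text verbatim): no `δ`-separated textured Nash translate of a
periodic point set is an `e⋆`-μGSC. [folklore] -/
theorem rGSCperQ_of_localCloseOrder
    (hLCO : ∀ X : Set (EuclideanSpace ℝ (Fin 3)), (0 : EuclideanSpace ℝ (Fin 3)) ∈ X → (∀ a ∈ X, ∀ b ∈ X, a ≠ b → (7 : ℝ) / 10 ≤ dist a b) → Literature.MathematicalPhysics.StatisticalMechanics.IsMuGSC Literature.MathematicalPhysics.StatisticalMechanics.lennardJones (⨅ Q : Literature.MathematicalPhysics.StatisticalMechanics.PeriodicConfiguration 3, Q.energyPerParticle Literature.MathematicalPhysics.StatisticalMechanics.lennardJones) X → ∃ p : EuclideanSpace ℝ (Fin 3), p ∈ X ∧ ∃ (d η γ : ℝ) (A : EuclideanSpace ℝ (Fin 3) →ₗᵢ[ℝ] EuclideanSpace ℝ (Fin 3)), (∃ t : ↥Literature.Geometry.DiscreteGeometry.fccKissingPattern → EuclideanSpace ℝ (Fin 3), 0 < d ∧ 0 < γ ∧ η < 1 / 20 ∧ (∀ u : ↥Literature.Geometry.DiscreteGeometry.fccKissingPattern,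 t u ∈ X ∧ ‖(t u - p) - d • A (u : EuclideanSpace ℝ (Fin 3))‖ ≤ η * d) ∧ (∀ s : EuclideanSpace ℝ (Fin 3), s ∈ X → s ≠ p → d ≤ dist s p) ∧ (∃ s : EuclideanSpace ℝ (Fin 3), s ∈ X ∧ s ≠ p ∧ dist s p ≤ d) ∧ (∀ s : EuclideanSpace ℝ (Fin 3), s ∈ X → s ≠ p → dist s p < 13 / 10 * d + γ → dist s p ≤ 13 / 10 * d - γ ∧ s ∈ Set.range t)) ∨ (∃ t : ↥Literature.Geometry.DiscreteGeometry.hcpKissingPattern → EuclideanSpace ℝ (Fin 3), 0 < d ∧ 0 < γ ∧ η < 1 / 20 ∧ (∀ u : ↥Literature.Geometry.DiscreteGeometry.hcpKissingPattern, t u ∈ X ∧ ‖(t u - p) - d • A (u : EuclideanSpace ℝ (Fin 3))‖ ≤ η * d) ∧ (∀ s : EuclideanSpace ℝ (Fin 3), s ∈ X → s ≠ p → d ≤ dist s p) ∧ (∃ s : EuclideanSpace ℝ (Fin 3), s ∈ X ∧ s ≠ p ∧ dist s p ≤ d) ∧ (∀ s : EuclideanSpace ℝ (Fin 3), s ∈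 X → s ≠ p → dist s p < 13 / 10 * d + γ → dist s p ≤ 13 / 10 * d - γ ∧ s ∈ Set.range t))) :
    ∀ δ : ℝ, 0 < δ → ∀ (Q : Literature.MathematicalPhysics.StatisticalMechanics.PeriodicConfiguration 3) (t : EuclideanSpace ℝ (Fin 3)), let Gy : ℝ → (N : ℕ) → (Fin N → EuclideanSpace ℝ (Fin 3)) → Fin N → Prop := fun η N y j => let d : ℝ := sInf ((fun z => dist z (y (j : Fin N))) '' (Set.range (y) \ {(y (j : Fin N))})); let T : Set (EuclideanSpace ℝ (Fin 3)) := {z : EuclideanSpace ℝ (Fin 3) | z ∈ Set.range (y) ∧ z ≠ (y (j : Fin N)) ∧ dist z (y (j : Fin N)) < 13 / 10 * d}; ∃ A : EuclideanSpace ℝ (Fin 3) →ₗᵢ[ℝ] EuclideanSpace ℝ (Fin 3), (∃ e : ↥T ≃ ↥Literature.Geometry.DiscreteGeometry.fccKissingPattern, ∀ t : ↥T, dist (d⁻¹ • ((t : EuclideanSpace ℝ (Fin 3)) - (y (j : Fin N)))) (A ((e t : ↥Literature.Geometry.DiscreteGeometry.fccKissingPattern) : EuclideanSpace ℝ (Fin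 3))) ≤ η) ∨ (∃ e : ↥T ≃ ↥Literature.Geometry.DiscreteGeometry.hcpKissingPattern, ∀ t : ↥T, dist (d⁻¹ • ((t : EuclideanSpace ℝ (Fin 3)) - (y (j : Fin N)))) (A ((e t : ↥Literature.Geometry.DiscreteGeometry.hcpKissingPattern) : EuclideanSpace ℝ (Fin 3))) ≤ η); let TexBall : (N : ℕ) → (Fin N → EuclideanSpace ℝ (Fin 3)) → Fin N → ℝ → ℝ → ℝ → ℝ → Prop := fun N y i R R₇ R₈ R₉ => (∀ a b : Fin N, a ≠ b → (7 : ℝ) / 10 ≤ dist (y a) (y b)) ∧ (∀ j : Fin N, dist (y j) (y i) ≤ R → ¬ Gy (1 / 20) N (y) j) ∧ (∀ j : Fin N, dist (y j) (y i) ≤ R → ¬ ((∀ j' : Fin N, dist (y j') (y j) ≤ R₇ → ¬ Gy (1 / 20) N (y) j') ∧ (∀ z : EuclideanSpace ℝ (Fin 3), dist z (y j) ≤ R₇ → ∃ k : Fin N, dist z (y k) ≤ 1) ∧ (∀ j' : Fin N, dist (y j') (y j) ≤ R₇ → (let d : ℝ := sInf ((fun z => dist z (y j')) '' (Set.range (y)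 \ {(y j')})); ∀ k : Fin N, y k ≠ y j' → dist (y k) (y j') < 27 / 20 * d → 5 ≤ Nat.card {m : Fin N // y m ≠ y j' ∧ dist (y m) (y j') < 27 / 20 * d ∧ y m ≠ y k ∧ dist (y m) (y k) < 27 / 20 * d})))) ∧ (∀ j : Fin N, dist (y j) (y i) ≤ R → ∃ k : Fin N, dist (y k) (y j) ≤ R₈ ∧ Gy (1 / 8) N (y) k) ∧ (∀ j : Fin N, dist (y j) (y i) ≤ R → ¬ ((∀ j' : Fin N, dist (y j') (y j) ≤ R₉ → ¬ Gy (1 / 20) N (y) j') ∧ (Nat.card {j' : Fin N // dist (y j') (y j) ≤ R₉ ∧ ¬ Gy (1 / 8) N (y) j'} : ℝ) ≤ 1 / 2 * (Nat.card {j' : Fin N // dist (y j') (y j) ≤ R₉} : ℝ) ∧ (∀ j' : Fin N, dist (y j') (y j) ≤ R₉ → ¬ Gy (1 / 8) N (y) j' → ¬ (let d : ℝ := sInf ((fun z => dist z (y j')) '' (Set.range (y) \ {(y j')})); ∀ k : Fin N, y k ≠ y j' → dist (y k) (y j') < 27 / 20 * d → 5 ≤ Nat.card {m : Fin N // y m ≠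 y j' ∧ dist (y m) (y j') < 27 / 20 * d ∧ y m ≠ y k ∧ dist (y m) (y k) < 27 / 20 * d})))); let ApprS : Set (EuclideanSpace ℝ (Fin 3)) → ℝ → ℝ → ℝ → Prop := fun S R₇ R₈ R₉ => ∀ q : EuclideanSpace ℝ (Fin 3), q ∈ S → ∀ R ε : ℝ, 0 < ε → ∃ (N : ℕ) (y : Fin N → EuclideanSpace ℝ (Fin 3)) (i : Fin N), TexBall N y i R R₇ R₈ R₉ ∧ (∀ p : EuclideanSpace ℝ (Fin 3), p ∈ S → dist p q ≤ R → ∃ k : Fin N, dist (y k - y i) (p - q) ≤ ε) ∧ (∀ k : Fin N, dist (y k) (y i) ≤ R → ∃ p : EuclideanSpace ℝ (Fin 3), p ∈ S ∧ dist (y k - y i) (p - q) ≤ ε); let NashS : Set (EuclideanSpace ℝ (Fin 3)) → Prop := fun S => ∀ p : EuclideanSpace ℝ (Fin 3), p ∈ S → ∀ y : EuclideanSpace ℝ (Fin 3), (∀ q : EuclideanSpace ℝ (Fin 3), q ∈ S → q ≠ p → y ≠ q) → ∑' q : {q : EuclideanSpace ℝ (Fin 3) // q ∈ S ∧ q ≠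 p}, Literature.MathematicalPhysics.StatisticalMechanics.lennardJones (dist p (q : EuclideanSpace ℝ (Fin 3))) ≤ ∑' q : {q : EuclideanSpace ℝ (Fin 3) // q ∈ S ∧ q ≠ p}, Literature.MathematicalPhysics.StatisticalMechanics.lennardJones (dist y (q : EuclideanSpace ℝ (Fin 3))); (∀ p ∈ ((fun s => s + t) '' Q.points), ∀ q ∈ ((fun s => s + t) '' Q.points), p ≠ q → δ ≤ dist p q) → (∃ R₇ R₈ R₉ : ℝ, ApprS ((fun s => s + t) '' Q.points) R₇ R₈ R₉) → NashS ((fun s => s + t) '' Q.points) → ¬ Literature.MathematicalPhysics.StatisticalMechanics.IsMuGSC Literature.MathematicalPhysics.StatisticalMechanics.lennardJones (⨅ Q : Literature.MathematicalPhysics.StatisticalMechanics.PeriodicConfiguration 3, Q.energyPerParticle Literature.MathematicalPhysics.StatisticalMechanics.lennardJones) ((fun s => s + t) '' Q.points) := by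
  intro δ hδ Q t
  dsimp only
  intro hsep happr _hnash
  obtain ⟨R₇, R₈, R₉, hAp⟩ := happr
  exact not_isMuGSC_of_textured_set hLCO hδ (Q.points_nonempty.image _) hsep fun q hq R ε hε => by
    obtain ⟨N, y, i, ⟨hs, h2, -, -, -⟩, hm1, hm2⟩ := hAp q hq R ε hε
    exact ⟨N, y, i, hs, h2, hm1, hm2⟩

/-- **`NoFrustratedPeriodicMinimiser` (crux D of `PeriodicChargeSplit`, item 26654) from `LCO`, DOOR-FREE.** [folklore] -/
theorem noFrustratedPeriodicMinimiser_of_localCloseOrder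
    (hLCO : ∀ X : Set (EuclideanSpace ℝ (Fin 3)), (0 : EuclideanSpace ℝ (Fin 3)) ∈ X → (∀ a ∈ X, ∀ b ∈ X, a ≠ b → (7 : ℝ) / 10 ≤ dist a b) → Literature.MathematicalPhysics.StatisticalMechanics.IsMuGSC Literature.MathematicalPhysics.StatisticalMechanics.lennardJones (⨅ Q : Literature.MathematicalPhysics.StatisticalMechanics.PeriodicConfiguration 3, Q.energyPerParticle Literature.MathematicalPhysics.StatisticalMechanics.lennardJones) X → ∃ p : EuclideanSpace ℝ (Fin 3), p ∈ X ∧ ∃ (d η γ : ℝ) (A : EuclideanSpace ℝ (Fin 3) →ₗᵢ[ℝ] EuclideanSpace ℝ (Fin 3)), (∃ t : ↥Literature.Geometry.DiscreteGeometry.fccKissingPattern → EuclideanSpace ℝ (Fin 3), 0 < d ∧ 0 < γ ∧ η < 1 / 20 ∧ (∀ u : ↥Literature.Geometry.DiscreteGeometry.fccKissingPattern, t u ∈ X ∧ ‖(t u - p) - d • A (u : EuclideanSpace ℝ (Fin 3))‖ ≤ η * d) ∧ (∀ s : EuclideanSpace ℝ (Fin 3), s ∈ X → s ≠ p → d ≤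 dist s p) ∧ (∃ s : EuclideanSpace ℝ (Fin 3), s ∈ X ∧ s ≠ p ∧ dist s p ≤ d) ∧ (∀ s : EuclideanSpace ℝ (Fin 3), s ∈ X → s ≠ p → dist s p < 13 / 10 * d + γ → dist s p ≤ 13 / 10 * d - γ ∧ s ∈ Set.range t)) ∨ (∃ t : ↥Literature.Geometry.DiscreteGeometry.hcpKissingPattern → EuclideanSpace ℝ (Fin 3), 0 < d ∧ 0 < γ ∧ η < 1 / 20 ∧ (∀ u : ↥Literature.Geometry.DiscreteGeometry.hcpKissingPattern, t u ∈ X ∧ ‖(t u - p) - d • A (u : EuclideanSpace ℝ (Fin 3))‖ ≤ η * d) ∧ (∀ s : EuclideanSpace ℝ (Fin 3), s ∈ X → s ≠ p → d ≤ dist s p) ∧ (∃ s : EuclideanSpace ℝ (Fin 3), s ∈ X ∧ s ≠ p ∧ dist s p ≤ d) ∧ (∀ s : EuclideanSpace ℝ (Fin 3), s ∈ X → s ≠ p → dist s p < 13 / 10 * d + γ → dist s p ≤ 13 / 10 * d - γ ∧ s ∈ Set.range t))) :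
    Summit.AtomisticToContinuum.Crystallization.Theses.PeriodicChargeSplit.NoFrustratedPeriodicMinimiser :=
  noFrustratedPeriodicMinimiser_of_noTexturedPeriodicGSC (rGSCperQ_of_localCloseOrder hLCO)

/-- **`PeriodicFrustratedLawGap` (item 27624) from `PeriodicMinimiserCharge` (item 26655) and `LCO`, DOOR-FREE.** [folklore] -/
theorem periodicFrustratedLawGap_of_charge_of_localCloseOrder
    (hC : Summit.AtomisticToContinuum.Crystallization.Theses.PeriodicChargeSplit.PeriodicMinimiserCharge)
    (hLCO : ∀ X : Set (EuclideanSpace ℝ (Fin 3)), (0 : EuclideanSpace ℝ (Fin 3)) ∈ X → (∀ a ∈ X, ∀ b ∈ X, a ≠ b → (7 : ℝ) / 10 ≤ dist a b) → Literature.MathematicalPhysics.StatisticalMechanics.IsMuGSC Literature.MathematicalPhysics.StatisticalMechanics.lennardJones (⨅ Q : Literature.MathematicalPhysics.StatisticalMechanics.PeriodicConfiguration 3, Q.energyPerParticle Literature.MathematicalPhysics.StatisticalMechanics.lennardJones) X → ∃ p : EuclideanSpace ℝ (Fin 3), p ∈ X ∧ ∃ (d η γ : ℝ) (A : EuclideanSpace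 ℝ (Fin 3) →ₗᵢ[ℝ] EuclideanSpace ℝ (Fin 3)), (∃ t : ↥Literature.Geometry.DiscreteGeometry.fccKissingPattern → EuclideanSpace ℝ (Fin 3), 0 < d ∧ 0 < γ ∧ η < 1 / 20 ∧ (∀ u : ↥Literature.Geometry.DiscreteGeometry.fccKissingPattern, t u ∈ X ∧ ‖(t u - p) - d • A (u : EuclideanSpace ℝ (Fin 3))‖ ≤ η * d) ∧ (∀ s : EuclideanSpace ℝ (Fin 3), s ∈ X → s ≠ p → d ≤ dist s p) ∧ (∃ s : EuclideanSpace ℝ (Fin 3), s ∈ X ∧ s ≠ p ∧ dist s p ≤ d) ∧ (∀ s : EuclideanSpace ℝ (Fin 3), s ∈ X → s ≠ p → dist s p < 13 / 10 * d + γ → dist s p ≤ 13 / 10 * d - γ ∧ s ∈ Set.range t)) ∨ (∃ t : ↥Literature.Geometry.DiscreteGeometry.hcpKissingPattern → EuclideanSpace ℝ (Fin 3), 0 < d ∧ 0 < γ ∧ η < 1 / 20 ∧ (∀ u : ↥Literature.Geometry.DiscreteGeometry.hcpKissingPattern, t u ∈ X ∧ ‖(t u - p) - d • A (u : EuclideanSpace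 ℝ (Fin 3))‖ ≤ η * d) ∧ (∀ s : EuclideanSpace ℝ (Fin 3), s ∈ X → s ≠ p → d ≤ dist s p) ∧ (∃ s : EuclideanSpace ℝ (Fin 3), s ∈ X ∧ s ≠ p ∧ dist s p ≤ d) ∧ (∀ s : EuclideanSpace ℝ (Fin 3), s ∈ X → s ≠ p → dist s p < 13 / 10 * d + γ → dist s p ≤ 13 / 10 * d - γ ∧ s ∈ Set.range t))) :
    Summit.AtomisticToContinuum.Crystallization.Theses.FrustratedLawDichotomy.PeriodicFrustratedLawGap :=
  periodicFrustratedLawGap_of_charge_of_noTexturedPeriodicGSC hC (rGSCperQ_of_localCloseOrder hLCO)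

/-- **`NoFrustratedPeriodicMinimiser` (item 26654) from the finite frustration density gap `FDG`, DOOR-FREE.** [folklore] -/
theorem noFrustratedPeriodicMinimiser_of_frustrationDensityGap
    (hFDG : ∃ κ : ℝ, 0 < κ ∧ ∃ C : ℝ, ∀ (N : ℕ) (y : Fin N → EuclideanSpace ℝ (Fin 3)), Function.Injective y → (∀ a b : Fin N, a ≠ b → (7 : ℝ) / 10 ≤ dist (y a) (y b)) → κ * N - C * (Nat.card {i : Fin N // ∃ (d η γ : ℝ) (A : EuclideanSpace ℝ (Fin 3) →ₗᵢ[ℝ] EuclideanSpace ℝ (Fin 3)), (∃ t : ↥Literature.Geometry.DiscreteGeometry.fccKissingPattern → EuclideanSpace ℝ (Fin 3), 0 < d ∧ 0 < γ ∧ η < 1 / 20 ∧ (∀ u : ↥Literature.Geometry.DiscreteGeometry.fccKissingPattern, t u ∈ (Set.range y) ∧ ‖(t u - (y i)) - d • A (u : EuclideanSpace ℝ (Fin 3))‖ ≤ η * d) ∧ (∀ s : EuclideanSpace ℝ (Fin 3), s ∈ (Set.range y) → s ≠ (y i) → d ≤ dist s (y i)) ∧ (∃ s : EuclideanSpace ℝ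 (Fin 3), s ∈ (Set.range y) ∧ s ≠ (y i) ∧ dist s (y i) ≤ d) ∧ (∀ s : EuclideanSpace ℝ (Fin 3), s ∈ (Set.range y) → s ≠ (y i) → dist s (y i) < 13 / 10 * d + γ → dist s (y i) ≤ 13 / 10 * d - γ ∧ s ∈ Set.range t)) ∨ (∃ t : ↥Literature.Geometry.DiscreteGeometry.hcpKissingPattern → EuclideanSpace ℝ (Fin 3), 0 < d ∧ 0 < γ ∧ η < 1 / 20 ∧ (∀ u : ↥Literature.Geometry.DiscreteGeometry.hcpKissingPattern, t u ∈ (Set.range y) ∧ ‖(t u - (y i)) - d • A (u : EuclideanSpace ℝ (Fin 3))‖ ≤ η * d) ∧ (∀ s : EuclideanSpace ℝ (Fin 3), s ∈ (Set.range y) → s ≠ (y i) → d ≤ dist s (y i)) ∧ (∃ s : EuclideanSpace ℝ (Fin 3), s ∈ (Set.range y) ∧ s ≠ (y i) ∧ dist s (y i) ≤ d) ∧ (∀ s : EuclideanSpace ℝ (Fin 3), s ∈ (Set.range y) → s ≠ (y i) → dist s (y i) < 13 / 10 * d + γ → dist s (y i) ≤ 13 / 10 * d - γ ∧ s ∈ Set.range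 t))} : ℝ) ≤ Literature.MathematicalPhysics.StatisticalMechanics.interactionEnergy Literature.MathematicalPhysics.StatisticalMechanics.lennardJones y - N * (⨅ Q : Literature.MathematicalPhysics.StatisticalMechanics.PeriodicConfiguration 3, Q.energyPerParticle Literature.MathematicalPhysics.StatisticalMechanics.lennardJones)) :
    Summit.AtomisticToContinuum.Crystallization.Theses.PeriodicChargeSplit.NoFrustratedPeriodicMinimiser :=
  noFrustratedPeriodicMinimiser_of_localCloseOrder (localCloseOrder_of_frustrationDensityGap hFDG)

/-- **`PeriodicFrustratedLawGap` (item 27624) from `PeriodicMinimiserCharge` and `FDG`, DOOR-FREE.** [folklore] -/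
theorem periodicFrustratedLawGap_of_charge_of_frustrationDensityGap
    (hC : Summit.AtomisticToContinuum.Crystallization.Theses.PeriodicChargeSplit.PeriodicMinimiserCharge)
    (hFDG : ∃ κ : ℝ, 0 < κ ∧ ∃ C : ℝ, ∀ (N : ℕ) (y : Fin N → EuclideanSpace ℝ (Fin 3)), Function.Injective y → (∀ a b : Fin N, a ≠ b → (7 : ℝ) / 10 ≤ dist (y a) (y b)) → κ * N - C * (Nat.card {i : Fin N // ∃ (d η γ : ℝ) (A : EuclideanSpace ℝ (Fin 3) →ₗᵢ[ℝ] EuclideanSpace ℝ (Fin 3)), (∃ t : ↥Literature.Geometry.DiscreteGeometry.fccKissingPattern → EuclideanSpace ℝ (Fin 3), 0 < d ∧ 0 < γ ∧ η < 1 / 20 ∧ (∀ u : ↥Literature.Geometry.DiscreteGeometry.fccKissingPattern, t u ∈ (Set.range y) ∧ ‖(t u - (y i)) - d • A (u : EuclideanSpace ℝ (Fin 3))‖ ≤ η * d) ∧ (∀ s : EuclideanSpace ℝ (Fin 3), s ∈ (Set.range y) → s ≠ (y i) → d ≤ dist s (y i)) ∧ (∃ s : EuclideanSpace ℝ (Fin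 3), s ∈ (Set.range y) ∧ s ≠ (y i) ∧ dist s (y i) ≤ d) ∧ (∀ s : EuclideanSpace ℝ (Fin 3), s ∈ (Set.range y) → s ≠ (y i) → dist s (y i) < 13 / 10 * d + γ → dist s (y i) ≤ 13 / 10 * d - γ ∧ s ∈ Set.range t)) ∨ (∃ t : ↥Literature.Geometry.DiscreteGeometry.hcpKissingPattern → EuclideanSpace ℝ (Fin 3), 0 < d ∧ 0 < γ ∧ η < 1 / 20 ∧ (∀ u : ↥Literature.Geometry.DiscreteGeometry.hcpKissingPattern, t u ∈ (Set.range y) ∧ ‖(t u - (y i)) - d • A (u : EuclideanSpace ℝ (Fin 3))‖ ≤ η * d) ∧ (∀ s : EuclideanSpace ℝ (Fin 3), s ∈ (Set.range y) → s ≠ (y i) → d ≤ dist s (y i)) ∧ (∃ s : EuclideanSpace ℝ (Fin 3), s ∈ (Set.range y) ∧ s ≠ (y i) ∧ dist s (y i) ≤ d) ∧ (∀ s : EuclideanSpace ℝ (Fin 3), s ∈ (Set.range y) → s ≠ (y i) → dist s (y i) < 13 / 10 * d + γ → dist s (y i) ≤ 13 / 10 * d - γ ∧ s ∈ Set.range t))}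 : ℝ) ≤ Literature.MathematicalPhysics.StatisticalMechanics.interactionEnergy Literature.MathematicalPhysics.StatisticalMechanics.lennardJones y - N * (⨅ Q : Literature.MathematicalPhysics.StatisticalMechanics.PeriodicConfiguration 3, Q.energyPerParticle Literature.MathematicalPhysics.StatisticalMechanics.lennardJones)) :
    Summit.AtomisticToContinuum.Crystallization.Theses.FrustratedLawDichotomy.PeriodicFrustratedLawGap :=
  periodicFrustratedLawGap_of_charge_of_localCloseOrder hC (localCloseOrder_of_frustrationDensityGap hFDG)

end Summit.AtomisticToContinuum.Crystallization.Theorems.FrustratedLawDichotomyLocalCloseOrderPeriodic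

end
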